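import Summits.QuantumFields.BalabanUV.Beta.SymSliceProjectorRules
import Summits.QuantumFields.BalabanUV.Beta.GaugeMultiplierBlockMean

/-!
# `BalabanUV.Beta.SymSliceProjectorFixed` — binder row D1, JSB12SYM-SPINE v1.1 (Σ3) step K2 part a: THE ROWS OF `symEc` ARE GAUGE-FIXED FORMS,
# `Π^{sym}_bm` IS LINEAR, and `symEc ∘ Π̂ᵀ_sym,C = symEc` (the projector-level half of rules 3–4 of `RelInv`)

CHART (RULING R-D1-g25-4): chart (II) — the FIXED κ = 0 slice at the CENTRED root; hSX separate.
HONEST FRAMING (cell contract, verbatim): «discharging `BetaPertH` makes Bałaban's UV stability UNCONDITIONAL — a real constructive-QFT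
result; it is NOT the continuum limit and NOT the Clay problem.»  THIS MODULE DISCHARGES NOTHING of `BetaPertH` ∕ row D1: [folklore] kernel
bookkeeping of OUR objects (pattern `RelInvBorderedHessian` §1–2: `axialGaugeAt_delta1_of_not_isCombBond`, `comp_axEc_piKBmC`).  0 sorry,
0 `def … : Prop`, nothing cited.  NOT HERE (K2 parts b–e): the gauge multiplier of the rows of `Π^{sym}_bm`, `resid ∘ Π̂ᵀ_sym`, blindness of `bhK`,
the `RelInv` assembly.  NOT D1, NOT BetaPertH, NOT continuum, NOT Clay.
HONEST DEPENDENCY (verbatim): «continuum YM on T⁴ ⇐ BetaPertH ∧ nine spine estimates (0/9 proved); BetaPertH ⇐ (D1) ∧ (D4) ∧ CAP+tail;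
G-an2-4 gates asym, D1 and NE2/3/4.»  ABSOLUTE RULE (cell, verbatim): «No internally-minted statement may enter as a cited fact. Every
hypothesis is either kernel-proved in this package or a verbatim quotation of a PUBLISHED theorem with page reference.»
Unit `b2b-balaban-beta-an2` gen 25 (row-D1 owner), 2026-08-21.
-/

namespace Summit.QuantumFields.BalabanUV.Beta.SymSliceProjectorFixed

noncomputable section

open Finset Matrix
open scoped BigOperators Nat
open Literature.MathematicalPhysics.QuantumFieldTheory
open Literature.MathematicalPhysics.QuantumFieldTheory.Balaban1983to89
open Literature.MathematicalPhysics.QuantumFieldTheory.Balaban1983to89.Beta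
open Literature.Probability.LatticeModels (Torus.proj)
open ExpKernelCalculus (MKer comp)
open AffineAveraging (Form0 Form1 Site box toSite unitVec unitVec_apply blockSum)
open AveragingContours (blk grad shift off off_mem_box blk_add_off blk_block)
open AveragingContoursRooted (ctr ctrOff ctrOff_mem_box)
open AxialProjector (lt_zsmul_blk_add)
open OneStepResolventKernel (Fib)
open Summit.QuantumFields.BalabanUV.Beta.TameKernelCalculus
open Summit.QuantumFields.BalabanUV.Beta.AxialDressingRooted
open Summit.QuantumFields.BalabanUV.Beta.AxialProjectorBlockMean (blockMeanAt)
open Summit.QuantumFields.BalabanUV.Beta.BorderedHessian (blockMeanAt_add grad_add)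
open Summit.QuantumFields.BalabanUV.Beta.SymmetrisedAxialPotential
open Summit.QuantumFields.BalabanUV.Beta.SymmetrisedAxialGauge
open Summit.QuantumFields.BalabanUV.Beta.SymmetrisedAxialGaugeBlockMean
open Summit.QuantumFields.BalabanUV.Beta.SymmetrisedDressingMatrix
open Summit.QuantumFields.BalabanUV.Beta.SymmetrisedDressingKernel
open Summit.QuantumFields.BalabanUV.Beta.KernelOrthoProjector
open Summit.QuantumFields.BalabanUV.Beta.SymSliceBlockMatrix
open Summit.QuantumFields.BalabanUV.Beta.SymSliceProjectorKernel
open Summit.QuantumFields.BalabanUV.Beta.SymSliceProjectorSpread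
open Summit.QuantumFields.BalabanUV.Beta.SymSliceProjectorRules

variable {d : ℕ}

/-! ## §1 Face-crossing bond indicators are gauge-fixed -/

/-- [folklore] A bond whose endpoints lie in one block is interior. -/
theorem isIntBond_of_blk_add_unitVec {N : ℕ} (hN : 1 ≤ N) {α : Fin (d + 1)} {x : Fin (d + 1) → ℤ} (h : blk N (x + unitVec α) = blk N x) :
    IsIntBond N α x := by
  unfold IsIntBond
  rw [mem_bIdxSet]
  refine ⟨off_mem_box hN x, ?_⟩
  have a1 := lt_zsmul_blk_add hN (x + unitVec α) α
  rw [h] at a1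
  have a2 := congrFun (blk_add_off hN x) α
  simp only [Pi.add_apply, toSite] at a2
  simp only [Pi.add_apply, unitVec_apply, if_true] at a1
  have a3 : ((off N x α : ℕ) : ℤ) + 1 < N := by linarith
  exact_mod_cast a3

/-- [folklore] **THE INDICATOR OF A FACE-CROSSING BOND HAS VANISHING SYMMETRISED TREE GAUGE EVERYWHERE** (in-block root: no contour inside a block uses it). -/
theorem symTreeGaugeAt_bondIndR_of_not_int {N : ℕ} (hN : 1 ≤ N) {r : Fin (d + 1) → ℕ} (hr : r ∈ box (d + 1) N) {α : Fin (d + 1)}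
    {x : Fin (d + 1) → ℤ} (hα : ¬ IsIntBond N α x) (z : Fin (d + 1) → ℤ) : symTreeGaugeAt (toSite r) (bondIndR α x) N z = 0 := by
  rw [symTreeGaugeAt_congr hN hr (A' := (0 : Form1 (d + 1) ℝ))]
  · exact symTreeGaugeAt_zero _ _ _
  · intro κ w hw hw'
    rw [bondIndR_apply, Pi.zero_apply, Pi.zero_apply]
    split_ifs with h
    · obtain ⟨rfl, rfl⟩ := h
      exact absurd (isIntBond_of_blk_add_unitVec hN (hw'.trans hw.symm)) hα
    · rfl

/-- [folklore] Hence the indicator of a face-crossing bond is gauge-fixed … -/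
theorem symAxialGaugeAt_bondIndR_of_not_int {N : ℕ} (hN : 1 ≤ N) {r : Fin (d + 1) → ℕ} (hr : r ∈ box (d + 1) N) {α : Fin (d + 1)}
    {x : Fin (d + 1) → ℤ} (hα : ¬ IsIntBond N α x) : SymAxialGaugeAt (toSite r) (bondIndR α x) N := by
  intro y b hb
  have h := symTreeGaugeAt_bondIndR_of_not_int hN hr hα ((N : ℤ) • y + toSite b)
  rw [symTreeGaugeAt, blk_block y hb] at h
  exact h

/-- [folklore] … and fixed by `Π^{sym}_bm`. -/
theorem symAxProjBmAt_bondIndR_of_not_int {N : ℕ} (hN : 1 ≤ N) {r : Fin (d + 1) → ℕ} (hr : r ∈ box (d + 1) N) {α : Fin (d + 1)}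
    {x : Fin (d + 1) → ℤ} (hα : ¬ IsIntBond N α x) : symAxProjBmAt (toSite r) N (bondIndR α x) = bondIndR α x :=
  symAxProjBmAt_eq_self_of_symAxialGaugeAt hN (symAxialGaugeAt_bondIndR_of_not_int hN hr hα)

/-! ## §2 The rows of `symEc` are gauge-fixed forms -/

/-- [our object] The field row of `symEc` at `(α, x)` as a one-form in the column index. -/
def rowE (N : ℕ) (x : Fin (d + 1) → ℤ) (α : Fin (d + 1)) : Form1 (d + 1) ℝ := fun γ y => symEc N x y (Sum.inl α) (Sum.inl γ)

/-- [folklore] The row of `Pmat` at `i` is a kernel vector of `Gmat` (`Pmat` symmetric, `Gmat · Pmat = 0`). -/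
theorem Gmat_mulVec_Pmat_row {N : ℕ} (hN : 1 ≤ N) (i : BIdx (d + 1) N) : Gmat N *ᵥ (fun j => Pmat N i j) = 0 := by
  have hP : ∀ j, Pmat N i j = Pmat N j i := fun j => by
    have := congrFun (congrFun (kerProj_transpose (Gmat (n := d + 1) N)) j) i
    rw [Matrix.transpose_apply] at this
    exact this
  have h0 : Gmat (n := d + 1) N * Pmat (n := d + 1) N = 0 := by rw [Pmat]; exact mul_kerProj (isUnit_det_gram_Gmat hN)
  funext z
  have hz := congrFun (congrFun h0 z) i
  rw [Matrix.mul_apply] at hz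
  rw [Pi.zero_apply, Matrix.mulVec, dotProduct]
  simp_rw [hP]
  exact hz

/-- [folklore] INTERIOR ROW: the row of `symEc` at an interior bond is the block translate of the kernel form of the `Pmat` row. -/
theorem rowE_of_int {N : ℕ} (hN : 1 ≤ N) {x : Fin (d + 1) → ℤ} {α : Fin (d + 1)} (hα : IsIntBond N α x) :
    rowE N x α = shift (-((N : ℤ) • blk N x)) (kernelForm N fun j => Pmat N ⟨(α, off N x), hα⟩ j) := by
  funext γ y
  simp only [rowE, shift, kernelForm]
  have hoff : off N (y + -((N : ℤ) • blk N x)) = off N y := by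
    have e : y + -((N : ℤ) • blk N x) = (N : ℤ) • (blk N y - blk N x) + toSite (off N y) := by
      rw [smul_sub]
      conv_lhs => rw [← blk_add_off hN y]
      abel
    rw [e]
    have h2 := blk_add_off hN ((N : ℤ) • (blk N y - blk N x) + toSite (off N y))
    rw [blk_block (blk N y - blk N x) (off_mem_box hN y)] at h2
    exact toSite_inj.1 (add_left_cancel h2)
  have hblk : blk N (y + -((N : ℤ) • blk N x)) = blk N y - blk N x := by
    have e : y + -((N : ℤ) • blk N x) = (N : ℤ) • (blk N y - blk N x) + toSite (off N y) := by
      rw [smul_sub]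
      conv_lhs => rw [← blk_add_off hN y]
      abel
    rw [e]
    exact blk_block _ (off_mem_box hN y)
  by_cases hγ : IsIntBond N γ y
  · rw [symEc_inl_inl_of_int hα hγ]
    have hmem : (γ, off N (y + -((N : ℤ) • blk N x))) ∈ bIdxSet (d + 1) N := by rw [hoff]; exact hγ
    by_cases hb : blk N x = blk N y
    · rw [if_pos hb, dif_pos ⟨hmem, by rw [hblk, hb, sub_self]⟩]
      congr 1
      apply Subtype.ext
      simp only [hoff]
    · rw [if_neg hb, dif_neg]
      rintro ⟨-, h2⟩
      rw [hblk, sub_eq_zero] at h2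
      exact hb h2.symm
  · rw [symEc_inl_inl_of_not_int (fun h => hγ h.2), dif_neg (fun h => hγ (by unfold IsIntBond; rw [← hoff]; exact h.1)), if_neg]
    rintro ⟨rfl, rfl⟩
    exact hγ hα

/-- [folklore] FACE-CROSSING ROW: the row of `symEc` at a non-interior bond is the bond's indicator. -/
theorem rowE_of_not_int {N : ℕ} {x : Fin (d + 1) → ℤ} {α : Fin (d + 1)} (hα : ¬ IsIntBond N α x) : rowE N x α = bondIndR α x := by
  funext γ y
  simp only [rowE]
  rw [symEc_inl_inl_of_not_int (fun h => hα h.1), bondIndR_apply]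
  by_cases h : x = y ∧ α = γ
  · rw [if_pos h, if_pos ⟨h.2.symm, h.1.symm⟩]
  · rw [if_neg h, if_neg (fun h' => h ⟨h'.2.symm, h'.1.symm⟩)]

/-- [folklore] **EVERY FIELD ROW OF `symEc` IS GAUGE-FIXED** (centred root, `N ≥ 1`). -/
theorem symAxialGaugeAt_rowE {N : ℕ} (hN : 1 ≤ N) (x : Fin (d + 1) → ℤ) (α : Fin (d + 1)) : SymAxialGaugeAt (ctr (d + 1) N) (rowE N x α) N := by
  by_cases hα : IsIntBond N α x
  · rw [rowE_of_int hN hα, ← smul_neg]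
    exact symAxialGaugeAt_shift_block _ (symAxialGaugeAt_kernelForm hN (Gmat_mulVec_Pmat_row hN _)) _
  · rw [rowE_of_not_int hα]
    exact symAxialGaugeAt_bondIndR_of_not_int hN (ctrOff_mem_box hN) hα

/-- [folklore] **`Π^{sym}_bm` FIXES EVERY FIELD ROW OF `symEc`** ((R34) in every block + §1). -/
theorem symAxProjBmAt_rowE {N : ℕ} (hN : 1 ≤ N) (x : Fin (d + 1) → ℤ) (α : Fin (d + 1)) :
    symAxProjBmAt (ctr (d + 1) N) N (rowE N x α) = rowE N x α :=
  symAxProjBmAt_eq_self_of_symAxialGaugeAt hN (r := ctrOff (d + 1) N) (symAxialGaugeAt_rowE hN x α)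

/-! ## §3 Linearity of `Π^{sym}_bm` and the window expansion of a form -/

/-- [folklore] Additivity of the gauge parameter. -/
theorem symGaugeAt_add (ρ : Site (d + 1)) (A B : Form1 (d + 1) ℝ) (N : ℕ) : symGaugeAt ρ (A + B) N = symGaugeAt ρ A N + symGaugeAt ρ B N := by
  funext x
  simp only [symGaugeAt, Pi.add_apply, symTreeGaugeAt_add]
  ring

/-- [folklore] Homogeneity of the gauge parameter. -/
theorem symGaugeAt_smul (ρ : Site (d + 1)) (c : ℝ) (A : Form1 (d + 1) ℝ) (N : ℕ) : symGaugeAt ρ (c • A) N = c • symGaugeAt ρ A N := by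
  funext x
  simp only [symGaugeAt, Pi.smul_apply, smul_eq_mul]
  have h : symTreeGaugeAt ρ (c • A) N x = c * symTreeGaugeAt ρ A N x := symTreeGaugeAt_mulLeft' ρ c A N x
  rw [h]
  ring

/-- [folklore] Homogeneity of the block mean. -/
theorem blockMeanAt_smul (N : ℕ) (c : ℝ) (f : Form0 (d + 1) ℝ) : blockMeanAt N (c • f) = c • blockMeanAt N f := by
  funext x
  simp only [blockMeanAt, blockSum, Pi.smul_apply, smul_eq_mul, ← Finset.mul_sum]
  ring

/-- [folklore] Homogeneity of the gradient. -/
theorem grad_smul (c : ℝ) (f : Form0 (d + 1) ℝ) : grad (c • f) = c • grad f := by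
  funext κ x
  simp only [grad, Pi.smul_apply, smul_eq_mul]
  ring

/-- [folklore] **`Π^{sym}_bm` IS ADDITIVE.** -/
theorem symAxProjBmAt_add (ρ : Site (d + 1)) (N : ℕ) (A B : Form1 (d + 1) ℝ) :
    symAxProjBmAt ρ N (A + B) = symAxProjBmAt ρ N A + symAxProjBmAt ρ N B := by
  unfold symAxProjBmAt symBmGaugeAt
  rw [symGaugeAt_add, blockMeanAt_add,
    show symGaugeAt ρ A N + symGaugeAt ρ B N - (blockMeanAt N (symGaugeAt ρ A N) + blockMeanAt N (symGaugeAt ρ B N))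
      = (symGaugeAt ρ A N - blockMeanAt N (symGaugeAt ρ A N)) + (symGaugeAt ρ B N - blockMeanAt N (symGaugeAt ρ B N)) by abel,
    grad_add]
  abel

/-- [folklore] **`Π^{sym}_bm` IS HOMOGENEOUS.** -/
theorem symAxProjBmAt_smul (ρ : Site (d + 1)) (N : ℕ) (c : ℝ) (A : Form1 (d + 1) ℝ) :
    symAxProjBmAt ρ N (c • A) = c • symAxProjBmAt ρ N A := by
  unfold symAxProjBmAt symBmGaugeAt
  rw [symGaugeAt_smul, blockMeanAt_smul, ← smul_sub, grad_smul, smul_sub]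

/-- [folklore] `Π^{sym}_bm 0 = 0`. -/
theorem symAxProjBmAt_zero (ρ : Site (d + 1)) (N : ℕ) : symAxProjBmAt ρ N (0 : Form1 (d + 1) ℝ) = 0 := by
  have h := symAxProjBmAt_smul ρ N 0 (0 : Form1 (d + 1) ℝ)
  rw [zero_smul, zero_smul] at h
  exact h

/-- [folklore] `Π^{sym}_bm` on a finite linear combination, entrywise. -/
theorem symAxProjBmAt_sum_smul {ι : Type*} (ρ : Site (d + 1)) (N : ℕ) (S : Finset ι) (c : ι → ℝ) (F : ι → Form1 (d + 1) ℝ)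
    (β : Fin (d + 1)) (w : Fin (d + 1) → ℤ) :
    symAxProjBmAt ρ N (∑ s ∈ S, c s • F s) β w = ∑ s ∈ S, c s * symAxProjBmAt ρ N (F s) β w := by
  classical
  induction S using Finset.induction_on with
  | empty => rw [Finset.sum_empty, Finset.sum_empty, symAxProjBmAt_zero]; rfl
  | insert a S ha ih =>
    rw [Finset.sum_insert ha, Finset.sum_insert ha, symAxProjBmAt_add, Pi.add_apply, Pi.add_apply, ih, symAxProjBmAt_smul,
      Pi.smul_apply, Pi.smul_apply, smul_eq_mul]

/-- [folklore] **WINDOW EXPANSION**: a form supported on the window `x + cube` is the finite combination of bond indicators there. -/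
theorem eq_sum_window_bondIndR {N : ℕ} {A : Form1 (d + 1) ℝ} {x : Fin (d + 1) → ℤ} (hA : ∀ γ y, A γ y ≠ 0 → y - x ∈ cube (d + 1) N) :
    A = ∑ p ∈ cube (d + 1) N ×ˢ (Finset.univ : Finset (Fin (d + 1))), A p.2 (x + p.1) • bondIndR p.2 (x + p.1) := by
  classical
  funext κ w
  rw [Finset.sum_apply, Finset.sum_apply]
  simp only [Pi.smul_apply, smul_eq_mul, bondIndR_apply, mul_ite, mul_one, mul_zero]
  by_cases hw : w - x ∈ cube (d + 1) N
  · rw [Finset.sum_eq_single (w - x, κ)]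
    · simp
    · rintro ⟨v, γ⟩ _ hne
      rw [if_neg]
      rintro ⟨rfl, hwv⟩
      exact hne (by rw [hwv]; simp)
    · intro h
      exact absurd (Finset.mem_product.2 ⟨hw, Finset.mem_univ _⟩) h
  · rw [Finset.sum_eq_zero]
    · by_contra h0
      exact hw (hA κ w h0)
    · rintro ⟨v, γ⟩ hp
      rw [if_neg]
      rintro ⟨rfl, rfl⟩
      exact hw (by simpa using (Finset.mem_product.1 hp).1)

/-! ## §4 `symEc ∘ Π̂ᵀ_sym = symEc` on the field block and `symEc ∘ Π̂ᵀ_sym,C = symEc` -/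

/-- [folklore] **FIELD BLOCK**: `(symEc ∘ Π̂ᵀ_sym)(x,α; x′,β) = (Π^{sym}_bm rowE_{(x,α)})_β(x′) = symEc(x,α; x′,β)`. -/
theorem comp_symEc_piKSymBm_inl_inl {N : ℕ} (hN : 1 ≤ N) (x x' : Fin (d + 1) → ℤ) (α β : Fin (d + 1)) :
    comp (symEc N) (piKSymBm (ctr (d + 1) N) N) x x' (Sum.inl α) (Sum.inl β) = symEc N x x' (Sum.inl α) (Sum.inl β) := by
  classical
  have hr : ctrOff (d + 1) N ∈ box (d + 1) N := ctrOff_mem_box hN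
  have hctr : ctr (d + 1) N = toSite (ctrOff (d + 1) N) := rfl
  unfold ExpKernelCalculus.comp
  -- the fibre sum at `y`
  have h : ∀ y, ∑ f : Fib d, symEc N x y (Sum.inl α) f * piKSymBm (ctr (d + 1) N) N y x' f (Sum.inl β) =
      if y - x ∈ cube (d + 1) N then ∑ γ : Fin (d + 1), rowE N x α γ y * symAxProjBmAt (ctr (d + 1) N) N (bondIndR γ y) β x' else 0 := by
    intro y
    rw [Fintype.sum_sum_type]
    simp only [piKSymBm_inr_inl, mul_zero, Finset.sum_const_zero, add_zero]
    by_cases hy : y - x ∈ cube (d + 1) N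
    · rw [if_pos hy]
      refine Finset.sum_congr rfl fun γ _ => ?_
      rw [hctr, piKSymBm_inl_inl_eq hN hr]
      rfl
    · rw [if_neg hy]
      refine Finset.sum_eq_zero fun γ _ => ?_
      have h0 : symEc N x y (Sum.inl α) (Sum.inl γ) = 0 := by
        by_contra hne; exact hy (symEc_inl_inl_window hN hne)
      rw [h0, zero_mul]
  simp_rw [h]
  rw [tsum_window]
  -- the window sum is `Π^{sym}_bm` of the window expansion of the row
  have hsupp : ∀ γ y, rowE N x α γ y ≠ 0 → y - x ∈ cube (d + 1) N := fun γ y hne => symEc_inl_inl_window hN hne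
  have hexp := eq_sum_window_bondIndR (N := N) hsupp
  have key : symAxProjBmAt (ctr (d + 1) N) N (rowE N x α) β x'
      = ∑ p ∈ cube (d + 1) N ×ˢ (Finset.univ : Finset (Fin (d + 1))), rowE N x α p.2 (x + p.1) * symAxProjBmAt (ctr (d + 1) N) N (bondIndR p.2 (x + p.1)) β x' := by
    conv_lhs => rw [hexp]
    rw [symAxProjBmAt_sum_smul]
  rw [Finset.sum_product] at key
  rw [← key, symAxProjBmAt_rowE hN]
  rfl

/-- [folklore] **`symEc ∘ Π̂ᵀ_sym,C = symEc`** (centred root, `N ≥ 1`; cf. `comp_axEc_piKBmC`). -/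
theorem comp_symEc_piKSymBmC {N : ℕ} (hN : 1 ≤ N) : comp (symEc N) (piKSymBmC (ctr (d + 1) N) N) = symEc (d := d) N := by
  classical
  funext x x' a b
  rcases a with α | m
  · rcases b with β | m'
    · rw [← comp_symEc_piKSymBm_inl_inl hN]
      unfold ExpKernelCalculus.comp
      refine tsum_congr fun y => Finset.sum_congr rfl fun f _ => ?_
      rcases f with γ | m
      · rfl
      · rw [symEc_inl_inr, zero_mul, zero_mul]
    · rw [symEc_inl_inr]
      unfold ExpKernelCalculus.comp
      have h : ∀ y, ∑ f : Fib d, symEc N x y (Sum.inl α) f * piKSymBmC (ctr (d + 1) N) N y x' f (Sum.inr m') = 0 := fun y =>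
        Finset.sum_eq_zero fun f _ => by
          rcases f with γ | m
          · rw [piKSymBmC_inl_inr, mul_zero]
          · rw [symEc_inl_inr, zero_mul]
      simp_rw [h]
      exact tsum_zero
  · rw [comp_symEc_apply_inr]
    rcases b with β | m'
    · rw [piKSymBmC_inr_inl, symEc_inr_inl, ite_self]
    · rw [piKSymBmC_inr_inr, symEc_inr_inr]
      by_cases hc : Torus.proj N x = 0
      · rw [if_pos hc]
      · rw [if_neg hc, if_neg (fun h => hc h.2.2)]

/-- [folklore] `Π̂_sym,C ∘ symEc = symEc` (transpose; `symEc` symmetric). -/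
theorem comp_trK_piKSymBmC_symEc {N : ℕ} (hN : 1 ≤ N) : comp (trK (piKSymBmC (ctr (d + 1) N) N)) (symEc N) = symEc (d := d) N := by
  conv_lhs => rw [← trK_symEc N]
  rw [← trK_comp, comp_symEc_piKSymBmC hN, trK_symEc]

end

end Summit.QuantumFields.BalabanUV.Beta.SymSliceProjectorFixed
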